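import Summits.CriticalPhenomena.PercolationContinuityZ3.Theorems.PercNearOneGluingNoHeavyLowerTailThreePointProductFormFibreSeriesPiece
import HarnessLib

/-!
# The series piece, II: pointwise description and the halving count (Sahi programme, prover prim-sahi-p2 gen 59)

Support file (`--supports stmt-CriticalPhenomena-4575`, helper); continues `…ThreePointProductFormFibreSeriesPiece` (same gen).
Standard axioms, no sorries, no named facts, no definitions.  Memo `run/shared/lean/prim/prim-sahi/FROM-prim-sahi-p2-gen59-ONE-STEP-LEMMA.md` §2, §8(2);
`prim-sahi-p2/PROOF-E3.md` (68j), §69.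

For the series piece `Q = {e} ∪ Qᵤ` (`e` a label `a — u`, the labels of `Qᵤ` avoiding `a`; `s, c ≠ a`) and the counts over all configurations
`z : α → Bool` of the sub-instance `w = z|_{Qᵤ}` with terminals `(s, u, c)` — `r = #S0 = #{s, c isolated}`, `p = #{c isolated}`, `q = #{s isolated}`,
`g = #good = #{S0 ∧ c ↮ s in the restricted flat at u}` — the six statistics of the piece w.r.t. `(s, a, c)` (`x = z|_Q`, flat `(♭ₐ x)|_Q`) satisfy
`2·#S0 = #{s ↮ c} + r`, `2·#isoC = #{s ↮ c} + p`, `2·#isoS = #{s ↮ c} + q`, `2·Ga = p + g`, `2·Gb = q + g`, `2·G1 = r + g` (companion file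
`…SeriesPieceCounts`, `two_mul_card_series_*`).  THIS FILE: the pointwise description in the two cases (`series_closed`: `e` closed — the piece is
the sub-instance with `a` detached and the flat re-attaches `a` to `u` along `e`; `series_open`: `e` open — `a` hangs on the cluster of `u` and the
flat is the flat at `u` with `a` detached) and the halving count by the involution flipping `e` (`two_mul_card_filter_split`).
[this work] (gen 59).
-/

namespace Summit.CriticalPhenomena.PercolationContinuityZ3.Theorems.ProductFormFibre

open Finset Literature.Probability.Percolation
open Summit.CriticalPhenomena.PercolationContinuityZ3.Theorems.ThreePointCPIClusterSwap (clusterFlip)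

variable {V α : Type*}

/-! ### 1. Halving by the flip of one label -/

section Halving

variable [Fintype α] [DecidableEq α]

/-- Flipping one label is an involution exchanging `{z e = false ∧ E}` and `{z e = true ∧ E}` for `E` blind to `e`; hence
`2·#{E, split by e} = #E₀ + #E₁`. [this work] -/
theorem two_mul_card_filter_split (e : α) (E E₀ E₁ : (α → Bool) → Prop) [DecidablePred E] [DecidablePred E₀] [DecidablePred E₁]
    (h₀ : ∀ z b, E₀ (Function.update z e b) ↔ E₀ z) (h₁ : ∀ z b, E₁ (Function.update z e b) ↔ E₁ z)
    (hE : ∀ z, E z ↔ (z e = false ∧ E₀ z) ∨ (z e = true ∧ E₁ z)) :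
    2 * (univ.filter E).card = (univ.filter E₀).card + (univ.filter E₁).card := by
  classical
  -- the flip and the half counts
  have half : ∀ (G : (α → Bool) → Prop) [DecidablePred G], (∀ z b, G (Function.update z e b) ↔ G z) →
      ∀ b : Bool, 2 * (univ.filter fun z => z e = b ∧ G z).card = (univ.filter G).card := by
    intro G _ hG b
    have hflip : (univ.filter fun z : α → Bool => z e = b ∧ G z).card = (univ.filter fun z : α → Bool => z e = !b ∧ G z).card := by
      refine Finset.card_nbij' (fun z => Function.update z e (!b)) (fun z => Function.update z e b) ?_ ?_ ?_ ?_
      · intro z hz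
        simp only [Finset.coe_filter, Finset.mem_univ, true_and, Set.mem_setOf_eq] at hz ⊢
        exact ⟨by simp, (hG z (!b)).2 hz.2⟩
      · intro z hz
        simp only [Finset.coe_filter, Finset.mem_univ, true_and, Set.mem_setOf_eq] at hz ⊢
        exact ⟨by simp, (hG z b).2 hz.2⟩
      · intro z hz
        simp only [Finset.coe_filter, Finset.mem_univ, true_and, Set.mem_setOf_eq] at hz
        funext y; by_cases hy : y = e
        · subst hy; simp [hz.1]
        · simp [hy]
      · intro z hz
        simp only [Finset.coe_filter, Finset.mem_univ, true_and, Set.mem_setOf_eq] at hz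
        funext y; by_cases hy : y = e
        · subst hy; simp [hz.1]
        · simp [hy]
    have hpart := Finset.card_filter_add_card_filter_not (s := univ.filter G) (fun z : α → Bool => z e = b)
    rw [Finset.filter_filter, Finset.filter_filter] at hpart
    have e1 : (univ.filter fun z : α → Bool => G z ∧ z e = b) = univ.filter fun z => z e = b ∧ G z :=
      Finset.filter_congr fun z _ => and_comm
    have e2 : (univ.filter fun z : α → Bool => G z ∧ ¬ z e = b) = univ.filter fun z => z e = !b ∧ G z :=
      Finset.filter_congr fun z _ => by
        constructor
        · rintro ⟨hg, hn⟩; exact ⟨by cases hz : z e <;> cases b <;> simp_all, hg⟩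
        · rintro ⟨hn, hg⟩; exact ⟨hg, by cases hz : z e <;> cases b <;> simp_all⟩
    rw [e1, e2, ← hflip] at hpart
    omega
  have hunion : (univ.filter E) =
      (univ.filter fun z : α → Bool => z e = false ∧ E₀ z) ∪ (univ.filter fun z => z e = true ∧ E₁ z) := by
    ext z; simp only [Finset.mem_filter, Finset.mem_univ, true_and, Finset.mem_union]; exact hE z
  have hdisj : Disjoint (univ.filter fun z : α → Bool => z e = false ∧ E₀ z) (univ.filter fun z => z e = true ∧ E₁ z) := by
    rw [Finset.disjoint_filter]; intro z _ h1 h2; rw [h1.1] at h2; exact Bool.false_ne_true h2.1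
  rw [hunion, Finset.card_union_of_disjoint hdisj, mul_add, half E₀ h₀ false, half E₁ h₁ true]

end Halving

/-! ### 2. The six statistics of the series piece -/

section Series

variable [DecidableEq α] [DecidableEq V]
  (ends : α → Sym2 V) (s a c u : V) (e : α) (Qu : α → Prop) [DecidablePred Qu]
  (he : ends e = s(a, u)) (hua : u ≠ a) (hsa : s ≠ a) (hca : c ≠ a) (hQu : ∀ l, Qu l → ∀ v ∈ ends l, v ≠ a) (heQ : ¬ Qu e)

omit [DecidableEq V] in
include heQ in
/-- The sub-instance configuration `z|_{Qᵤ}` is blind to the label `e`. [this work] -/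
theorem restrictU_update (z : α → Bool) (b : Bool) :
    (fun y => Function.update z e b y && decide (Qu y)) = fun y => z y && decide (Qu y) := by
  funext y
  by_cases hy : y = e
  · subst hy; simp [heQ]
  · simp [hy]

omit [DecidableEq V] in
include heQ in
/-- Pointwise form of `restrictU_update`. [this work] -/
theorem restrictU_update_apply (z : α → Bool) (b : Bool) (y : α) :
    (Function.update z e b y && decide (Qu y)) = (z y && decide (Qu y)) := by
  by_cases hy : y = e
  · subst hy; simp [heQ]
  · simp [hy]

include he hua hQu heQ in
/-- **Pointwise description, `e` closed**: the piece is the sub-instance with `a` detached, and the restricted flat re-attaches `a` to `u`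
along `e` and leaves `Qᵤ` unchanged. [this work] -/
theorem series_closed (z : α → Bool) (hz : z e = false) {t : V} (ht : t ≠ a) {t' : V} (ht' : t' ≠ a) :
    ((openGraph (labelledOpen ends fun y => z y && decide (y = e ∨ Qu y))).Reachable t a ↔ False) ∧
    ((openGraph (labelledOpen ends fun y => z y && decide (y = e ∨ Qu y))).Reachable t t' ↔
      (openGraph (labelledOpen ends fun y => z y && decide (Qu y))).Reachable t t') ∧
    ((openGraph (labelledOpen ends fun l =>
        clusterFlip ends a (fun y => !(z y && decide (y = e ∨ Qu y))) l && decide (l = e ∨ Qu l))).Reachable t a ↔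
      (openGraph (labelledOpen ends fun y => z y && decide (Qu y))).Reachable t u) ∧
    ((openGraph (labelledOpen ends fun l =>
        clusterFlip ends a (fun y => !(z y && decide (y = e ∨ Qu y))) l && decide (l = e ∨ Qu l))).Reachable t t' ↔
      (openGraph (labelledOpen ends fun y => z y && decide (Qu y))).Reachable t t') := by
  classical
  have hxs : ∀ l, (z l && decide (l = e ∨ Qu l)) = true → l = e ∨ Qu l := fun l h => by
    simp only [Bool.and_eq_true, decide_eq_true_eq] at h; exact h.2
  have hxu : (fun y => (z y && decide (y = e ∨ Qu y)) && decide (Qu y)) = fun y => z y && decide (Qu y) := by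
    funext y; by_cases h : Qu y <;> simp [h]
  -- the restricted flat, `e` closed: `e` open, `Qᵤ` as in `z`
  set G : α → Bool := fun l => clusterFlip ends a (fun y => !(z y && decide (y = e ∨ Qu y))) l && decide (l = e ∨ Qu l) with hG
  have hGe : G e = true := by
    simp only [hG, flat_series_apex ends a u e Qu he z, hz]; simp
  have hGu : ∀ l, Qu l → G l = z l := fun l hl => by
    simp only [hG, flat_series_apply ends a u e Qu he hua hQu heQ z hl, hz]; simp [hl]
  have hGs : ∀ l, G l = true → l = e ∨ Qu l := fun l h => by
    simp only [hG, Bool.and_eq_true, decide_eq_true_eq] at h; exact h.2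
  have hGw : (fun y => G y && decide (Qu y)) = fun y => z y && decide (Qu y) := by
    funext y; by_cases h : Qu y
    · simp [hGu y h, h]
    · simp [h]
  refine ⟨?_, ?_, ?_, ?_⟩
  · rw [SimpleGraph.reachable_comm, reachable_apex_series_iff ends a u e Qu he hua hQu heQ _ hxs ht]
    simp [hz]
  · rw [reachable_series_iff ends a u e Qu he hua hQu heQ _ hxs ht ht', hxu]
  · rw [SimpleGraph.reachable_comm, reachable_apex_series_iff ends a u e Qu he hua hQu heQ G hGs ht, hGw]
    simp only [hGe, true_and]
    exact SimpleGraph.reachable_comm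
  · rw [reachable_series_iff ends a u e Qu he hua hQu heQ G hGs ht ht', hGw]

include he hua hQu heQ in
/-- **Pointwise description, `e` open**: `a` is joined exactly to the cluster of `u`, the sub-instance is unchanged between non-apex
vertices, and the restricted flat is the restricted flat at `u` of the sub-instance with `a` detached. [this work] -/
theorem series_open (z : α → Bool) (hz : z e = true) {t : V} (ht : t ≠ a) {t' : V} (ht' : t' ≠ a) :
    ((openGraph (labelledOpen ends fun y => z y && decide (y = e ∨ Qu y))).Reachable t a ↔
      (openGraph (labelledOpen ends fun y => z y && decide (Qu y))).Reachable t u) ∧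
    ((openGraph (labelledOpen ends fun y => z y && decide (y = e ∨ Qu y))).Reachable t t' ↔
      (openGraph (labelledOpen ends fun y => z y && decide (Qu y))).Reachable t t') ∧
    ((openGraph (labelledOpen ends fun l =>
        clusterFlip ends a (fun y => !(z y && decide (y = e ∨ Qu y))) l && decide (l = e ∨ Qu l))).Reachable t a ↔ False) ∧
    ((openGraph (labelledOpen ends fun l =>
        clusterFlip ends a (fun y => !(z y && decide (y = e ∨ Qu y))) l && decide (l = e ∨ Qu l))).Reachable t t' ↔
      (openGraph (labelledOpen ends fun l => clusterFlip ends u (fun y => !(z y && decide (Qu y))) l && decide (Qu l))).Reachable t t') := by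
  classical
  have hxs : ∀ l, (z l && decide (l = e ∨ Qu l)) = true → l = e ∨ Qu l := fun l h => by
    simp only [Bool.and_eq_true, decide_eq_true_eq] at h; exact h.2
  have hxu : (fun y => (z y && decide (y = e ∨ Qu y)) && decide (Qu y)) = fun y => z y && decide (Qu y) := by
    funext y; by_cases h : Qu y <;> simp [h]
  set G : α → Bool := fun l => clusterFlip ends a (fun y => !(z y && decide (y = e ∨ Qu y))) l && decide (l = e ∨ Qu l) with hG
  set Fu : α → Bool := fun l => clusterFlip ends u (fun y => !(z y && decide (Qu y))) l && decide (Qu l) with hFu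
  have hGF : G = Fu := by
    funext l
    by_cases hle : l = e
    · subst hle
      simp only [hG, hFu, flat_series_apex ends a u _ Qu he z, hz, heQ]; simp
    · by_cases hl : Qu l
      · simp only [hG, hFu, flat_series_apply ends a u e Qu he hua hQu heQ z hl, hz, hl, hle]; simp
      · simp [hG, hFu, hl, hle]
  have hFs : ∀ l, Fu l = true → l = e ∨ Qu l := fun l h => by
    simp only [hFu, Bool.and_eq_true, decide_eq_true_eq] at h; exact Or.inr h.2
  have hFe : Fu e = false := by simp [hFu, heQ]
  have hFw : (fun y => Fu y && decide (Qu y)) = Fu := by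
    funext y; by_cases h : Qu y <;> simp [hFu, h]
  refine ⟨?_, ?_, ?_, ?_⟩
  · rw [SimpleGraph.reachable_comm, reachable_apex_series_iff ends a u e Qu he hua hQu heQ _ hxs ht, hxu]
    constructor
    · rintro ⟨-, h⟩; exact h.symm
    · intro h; exact ⟨by simp [hz], h.symm⟩
  · rw [reachable_series_iff ends a u e Qu he hua hQu heQ _ hxs ht ht', hxu]
  · rw [hGF, SimpleGraph.reachable_comm, reachable_apex_series_iff ends a u e Qu he hua hQu heQ Fu hFs ht, hFe]
    simp
  · rw [hGF, reachable_series_iff ends a u e Qu he hua hQu heQ Fu hFs ht ht', hFw]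


end Series

end Summit.CriticalPhenomena.PercolationContinuityZ3.Theorems.ProductFormFibre
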